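import Literature.Barriers.CriticalPhenomena.PlanarEdwardsModelDiffusiveProofs
import HarnessLib

/-!
# Lévy's maximal inequality for the planar simple random walk (reflection), and the
# fourth-moment tail bound for its running maximum

Sibling proof file of `Literature.Barriers.CriticalPhenomena.PlanarEdwardsModelDiffusive`
(step-sequence coding `Edwards2D.StepSeq`, `pos`, `endpoint` of the planar simple random walk)
towards the tightness half (D-a) of Donsker's theorem for the rescaled walks
(`Edwards2D.Stoll1989_invariance_of_isTight_of_fdd_of_mollify`). Everything is a finite counting
statement over the `4ᵐ` walks (uniform measure = Lawler's `P`):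

* `card_filter_exists_normSq_pos_le` — **Lévy's inequality**
  `P[∃ k ≤ m, |ω(k)|² ≥ c] ≤ 2 P[|ω(m)|² ≥ c]`, by the reflection `ω ↦ ω̃` reversing every step
  after the first passage time `τ` of `{|x|² ≥ c}`: `ω̃(m) = 2ω(τ) - ω(m)`, so `|ω(m)|² < c` and
  `|ω̃(m)|² < c` would give `4|ω(τ)|² = |ω(m) + ω̃(m)|² ≤ 2|ω(m)|² + 2|ω̃(m)|² < 4c` (parallelogram
  bound), a contradiction; the reflection is an involution preserving `τ`;
* `expect_ite_exists_normSq_pos_le` — the same for uniform averages of indicators;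
* `expect_ite_normSq_endpoint_le` — Markov with the fourth moment `⟨|ω(m)|⁴⟩_P = 2m² - m`
  (`expect_normSq_endpoint_sq`): `P[|ω(m)|² ≥ c] ≤ (2m² - m)/c²`;
* `expect_ite_exists_normSq_pos_le_of_pos` — hence `P[max_{k ≤ m} |ω(k)|² ≥ c] ≤ 2(2m² - m)/c²`.

## References

* P. Billingsley, *Convergence of Probability Measures*, 2nd ed. (1999), §10 (maximal
  inequalities; Etemadi's inequality (10.7)) and proof of Theorem 8.2 (Donsker) via (7.11).
* G. F. Lawler, *Intersections of Random Walks* (1991), §1.2–1.3 (reflection arguments).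
-/

noncomputable section

open Finset
open scoped BigOperators

namespace Literature.Barriers.CriticalPhenomena

namespace Edwards2D

open Literature.Probability.LatticeModels Literature.Probability.Percolation
open Literature.Probability.RandomPlanarGeometry.SAW.Zd (normSq)

variable {m : ℕ}

/-! ### The step reversal and the reflection of a walk after a time -/

/-- Reversing a step negates it: with `r = (0 1)(2 3)` on the four steps, `e_{r a} = -e_a`.
[folklore] -/
theorem stepVec_rev (a : Fin 4) : stepVec ((![1, 0, 3, 2] : Fin 4 → Fin 4) a) = -stepVec a := by
  fin_cases a <;> simp

/-- The step reversal is an involution. [folklore] -/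
theorem rev_rev (a : Fin 4) : (![1, 0, 3, 2] : Fin 4 → Fin 4) ((![1, 0, 3, 2] : Fin 4 → Fin 4) a) = a := by
  fin_cases a <;> rfl

/-- Positions of the walk reflected after time `τ` (steps with index `≥ τ` reversed): up to time
`τ` nothing changes. [folklore] -/
theorem pos_reflect_of_le (ω : StepSeq m) (τ : ℕ) {k : ℕ} (hk : k ≤ τ) :
    pos (fun i => if (i : ℕ) < τ then ω i else (![1, 0, 3, 2] : Fin 4 → Fin 4) (ω i)) k = pos ω k := by
  unfold pos
  refine Finset.sum_congr rfl fun i _ => ?_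
  by_cases hi : (i : ℕ) < k
  · simp [hi, lt_of_lt_of_le hi hk]
  · simp [hi]

/-- Positions of the walk reflected after time `τ`: after `τ` the position is reflected through
`ω(τ)`, `ω̃(k) + ω(k) = 2ω(τ)` for `k ≥ τ`. [folklore] -/
theorem pos_reflect_add_pos (ω : StepSeq m) (τ : ℕ) {k : ℕ} (hk : τ ≤ k) :
    pos (fun i => if (i : ℕ) < τ then ω i else (![1, 0, 3, 2] : Fin 4 → Fin 4) (ω i)) k + pos ω k =
      2 • pos ω τ := by
  unfold pos
  rw [← Finset.sum_add_distrib, Finset.smul_sum]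
  refine Finset.sum_congr rfl fun i _ => ?_
  by_cases hi : (i : ℕ) < τ
  · simp [hi, lt_of_lt_of_le hi hk, two_smul]
  · by_cases hik : (i : ℕ) < k
    · simp [hi, hik, stepVec_rev]
    · simp [hi, hik]

/-- Reflecting twice after the same time gives back the walk. [folklore] -/
theorem reflect_reflect (ω : StepSeq m) (τ : ℕ) :
    (fun i : Fin m => if (i : ℕ) < τ then
        (fun j : Fin m => if (j : ℕ) < τ then ω j else (![1, 0, 3, 2] : Fin 4 → Fin 4) (ω j)) i
      else (![1, 0, 3, 2] : Fin 4 → Fin 4)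
        ((fun j : Fin m => if (j : ℕ) < τ then ω j else (![1, 0, 3, 2] : Fin 4 → Fin 4) (ω j)) i)) = ω := by
  funext i
  by_cases hi : (i : ℕ) < τ
  · simp [hi]
  · simp [hi, rev_rev]

/-- The parallelogram bound `|a + b|² ≤ 2|a|² + 2|b|²` on `ℤ²`. [folklore] -/
theorem normSq_add_le (a b : Site 2) : normSq (a + b) ≤ 2 * normSq a + 2 * normSq b := by
  simp only [normSq, Fin.sum_univ_two, Pi.add_apply, Int.cast_add]
  nlinarith [sq_nonneg ((a 0 : ℝ) - b 0), sq_nonneg ((a 1 : ℝ) - b 1)]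

/-- `|2a|² = 4|a|²`. [folklore] -/
theorem normSq_two_smul (a : Site 2) : normSq (2 • a) = 4 * normSq a := by
  simp only [normSq, Fin.sum_univ_two, Pi.smul_apply, nsmul_eq_mul]
  push_cast
  ring

/-! ### Lévy's maximal inequality -/

open Classical in
/-- **Lévy's maximal inequality for the planar simple random walk** (reflection principle):
`#{ω : ∃ k ≤ m, |ω(k)|² ≥ c} ≤ 2 #{ω : |ω(m)|² ≥ c}`. [cite: Billingsley1999, §10] -/
theorem card_filter_exists_normSq_pos_le (m : ℕ) (c : ℝ) :
    #{ω : StepSeq m | ∃ k ≤ m, c ≤ normSq (pos ω k)} ≤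
      2 * #{ω : StepSeq m | c ≤ normSq (endpoint ω)} := by
  set A : Finset (StepSeq m) := {ω | ∃ k ≤ m, c ≤ normSq (pos ω k)} with hA
  set B : Finset (StepSeq m) := {ω | c ≤ normSq (endpoint ω)} with hB
  -- first passage time and reflection
  have hex : ∀ ω ∈ A, ∃ k, k ≤ m ∧ c ≤ normSq (pos ω k) := fun ω hω => by
    simpa [hA] using hω
  let τ : StepSeq m → ℕ := fun ω => if h : ω ∈ A then Nat.find (hex ω h) else 0
  have hτ : ∀ ω ∈ A, τ ω ≤ m ∧ c ≤ normSq (pos ω (τ ω)) ∧ ∀ k < τ ω, ¬ c ≤ normSq (pos ω k) := by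
    intro ω hω
    have h1 := Nat.find_spec (hex ω hω)
    refine ⟨by simpa [τ, hω] using h1.1, by simpa [τ, hω] using h1.2, fun k hk => ?_⟩
    have hk' : k < Nat.find (hex ω hω) := by simpa [τ, hω] using hk
    have := Nat.find_min (hex ω hω) hk'
    exact fun hc => this ⟨(hk'.le.trans h1.1), hc⟩
  let Φ : StepSeq m → StepSeq m := fun ω i =>
    if (i : ℕ) < τ ω then ω i else (![1, 0, 3, 2] : Fin 4 → Fin 4) (ω i)
  -- `Φ` preserves the first passage time on `A`
  have hΦA : ∀ ω ∈ A, Φ ω ∈ A ∧ τ (Φ ω) = τ ω := by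
    intro ω hω
    obtain ⟨hτm, hτc, hτmin⟩ := hτ ω hω
    have hposle : ∀ k ≤ τ ω, pos (Φ ω) k = pos ω k := fun k hk => pos_reflect_of_le ω (τ ω) hk
    have hΦωA : Φ ω ∈ A := by
      simp only [hA, Finset.mem_filter, Finset.mem_univ, true_and]
      exact ⟨τ ω, hτm, by rw [hposle _ le_rfl]; exact hτc⟩
    refine ⟨hΦωA, ?_⟩
    obtain ⟨-, hτc', hτmin'⟩ := hτ (Φ ω) hΦωA
    -- `τ (Φ ω) ≤ τ ω` by minimality for `Φ ω`, and `≥` by minimality for `ω`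
    refine le_antisymm ?_ ?_
    · by_contra hlt
      exact hτmin' (τ ω) (not_le.1 hlt) (by rw [hposle _ le_rfl]; exact hτc)
    · by_contra hlt
      have := hτmin (τ (Φ ω)) (not_le.1 hlt)
      rw [← hposle _ (not_le.1 hlt).le] at this
      exact this hτc'
  have hΦΦ : ∀ ω ∈ A, Φ (Φ ω) = ω := by
    intro ω hω
    have hτeq := (hΦA ω hω).2
    change (fun i : Fin m => if (i : ℕ) < τ (Φ ω) then (Φ ω) i
      else (![1, 0, 3, 2] : Fin 4 → Fin 4) ((Φ ω) i)) = ω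
    rw [hτeq]
    exact reflect_reflect ω (τ ω)
  -- `Φ` maps `A \ B` into `B`
  have hmaps : ∀ ω ∈ A \ B, Φ ω ∈ B := by
    intro ω hω
    rw [Finset.mem_sdiff] at hω
    obtain ⟨hωA, hωB⟩ := hω
    obtain ⟨hτm, hτc, -⟩ := hτ ω hωA
    simp only [hB, Finset.mem_filter, Finset.mem_univ, true_and, not_le] at hωB ⊢
    by_contra hlt
    rw [not_le] at hlt
    have hsum : pos (Φ ω) m + pos ω m = 2 • pos ω (τ ω) := pos_reflect_add_pos ω (τ ω) hτm
    have h4 : 4 * normSq (pos ω (τ ω)) < 4 * c := by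
      calc 4 * normSq (pos ω (τ ω)) = normSq (pos (Φ ω) m + pos ω m) := by
            rw [hsum, normSq_two_smul]
        _ ≤ 2 * normSq (pos (Φ ω) m) + 2 * normSq (pos ω m) := normSq_add_le _ _
        _ < 2 * c + 2 * c := by
            have e1 : normSq (pos (Φ ω) m) < c := by rw [pos_eq_endpoint]; exact hlt
            have e2 : normSq (pos ω m) < c := by rw [pos_eq_endpoint]; exact hωB
            linarith
        _ = 4 * c := by ring
    linarith
  -- counting
  have hinj : Set.InjOn Φ ↑(A \ B) := by
    intro ω hω ω' hω' h
    have hωA : ω ∈ A := (Finset.mem_sdiff.1 hω).1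
    have hω'A : ω' ∈ A := (Finset.mem_sdiff.1 hω').1
    rw [← hΦΦ ω hωA, ← hΦΦ ω' hω'A, h]
  calc #A = #(A \ B) + #(A ∩ B) := (Finset.card_sdiff_add_card_inter A B).symm
    _ ≤ #B + #B := add_le_add (Finset.card_le_card_of_injOn Φ hmaps hinj)
        (Finset.card_le_card Finset.inter_subset_right)
    _ = 2 * #B := by ring

open Classical in
/-- **Lévy's maximal inequality**, uniform-average form:
`P[∃ k ≤ m, |ω(k)|² ≥ c] ≤ 2 P[|ω(m)|² ≥ c]`. [cite: Billingsley1999, §10] -/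
theorem expect_ite_exists_normSq_pos_le (m : ℕ) (c : ℝ) :
    𝔼 ω : StepSeq m, (if ∃ k ≤ m, c ≤ normSq (pos ω k) then (1 : ℝ) else 0) ≤
      2 * 𝔼 ω : StepSeq m, (if c ≤ normSq (endpoint ω) then (1 : ℝ) else 0) := by
  rw [Finset.expect_eq_sum_div_card, Finset.expect_eq_sum_div_card, Finset.sum_boole,
    Finset.sum_boole, mul_div_assoc']
  refine div_le_div_of_nonneg_right ?_ (by positivity)
  exact_mod_cast card_filter_exists_normSq_pos_le m c

open Classical in
/-- **Fourth-moment tail bound** (Markov): `P[|ω(m)|² ≥ c] ≤ ⟨|ω(m)|⁴⟩_P / c² = (2m² - m)/c²` for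
`c > 0`. [cite: Lawler1991, §6.3 (moments of |ω(n)|²)] -/
theorem expect_ite_normSq_endpoint_le (m : ℕ) {c : ℝ} (hc : 0 < c) :
    𝔼 ω : StepSeq m, (if c ≤ normSq (endpoint ω) then (1 : ℝ) else 0) ≤
      (2 * (m : ℝ) ^ 2 - m) / c ^ 2 := by
  rw [← expect_normSq_endpoint_sq, le_div_iff₀ (by positivity), Finset.expect_mul]
  refine Finset.expect_le_expect fun ω _ => ?_
  split_ifs with h
  · rw [one_mul]
    exact pow_le_pow_left₀ hc.le h 2
  · rw [zero_mul]
    positivity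

open Classical in
/-- **Tail of the running maximum of the planar simple random walk**:
`P[max_{k ≤ m} |ω(k)|² ≥ c] ≤ 2(2m² - m)/c²` (Lévy + Markov with the fourth moment) — the
estimate behind the tightness of the diffusively rescaled walks.
[cite: Billingsley1999, §10 and proof of Theorem 8.2] -/
theorem expect_ite_exists_normSq_pos_le_of_pos (m : ℕ) {c : ℝ} (hc : 0 < c) :
    𝔼 ω : StepSeq m, (if ∃ k ≤ m, c ≤ normSq (pos ω k) then (1 : ℝ) else 0) ≤
      2 * ((2 * (m : ℝ) ^ 2 - m) / c ^ 2) :=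
  (expect_ite_exists_normSq_pos_le m c).trans
    (mul_le_mul_of_nonneg_left (expect_ite_normSq_endpoint_le m hc) zero_le_two)

end Edwards2D

end Literature.Barriers.CriticalPhenomena

end
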